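import Mathlib
import Literature.AlgebraicGeometry.Resolution.VertexInitialForms
import Literature.AlgebraicGeometry.Resolution.HironakaDirectrix
import HarnessLib

/-!
# Adapted systems: `δ > 1` versus the directrix `(Y)`

Topic: `Literature/AlgebraicGeometry/Resolution`. The dictionary between the Newton-polygon
condition `δ(J; y, u) > 1` and Hironaka's initial forms (Cossart–Jannsen–Saito, LNM 2270,
Definition 8.4 / (12.1): "`δ(f, y, u) > 1` since `(y, u)` is admissible", i.e. `in_𝔪(f_i) = F_i(Y)`;
Cossart–Piltant 2008, §4 p. 11: "`(y, u₁, u₂)` such that `T_x = k(x)·Y`", and p. 12: "`δ(x) > 1`,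
since `E` has multiplicity `μ` in `x`"). For an ideal `J ⊆ 𝔪^μ` of a three-dimensional regular
local ring and a regular system of parameters `c = (y, u₁, u₂)` we PROVE (no facts):

* `inForm_one_eq_map` — for a form `F` of degree `μ` with `F(c) = f`, the `𝔪`-adic initial form
  `in_μ(f)` (the weight-`(1,1,1)` initial form of `WeightedInitialForms`) is `F̄`;
* `initialForms_eq_setOf_inForm` — `cl_μ(J) = {in_μ(f) : f ∈ J}` (`J ⊆ 𝔪^μ`);
* `forall_initialForms_of_lt_deltaS` — **`δ > 1 ⇒ cl_μ(J) ⊆ k · Y^μ`** (every initial form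
  is a multiple of `Y^μ`: `y` is adapted to the directrix and `τ ≤ 1`);
* `lt_deltaS_of_forall_initialForms` — **`cl_μ(J) ⊆ k · Y^μ ⇒ δ > 1`** (Newton points present).

## Sources

* V. Cossart, U. Jannsen, S. Saito, LNM 2270 (2020), Def. 8.4, (12.1). [CossartJannsenSaito2020]
* V. Cossart, O. Piltant, J. Algebra 320 (2008), §4, pp. 11–12. [CossartPiltant2008]
-/

noncomputable section

open IsLocalRing MvPolynomial

namespace Literature.AlgebraicGeometry.Resolution

universe u

section Adapted

variable {R : Type u} [CommRing R] [IsRegularLocalRing R] (c : Fin 3 → R)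
  (hgen : Ideal.span {c 0, c 1, c 2} = maximalIdeal R) (hdim : ringKrullDim R = 3)
  {J : Ideal R} {μ : ℕ}

omit [IsRegularLocalRing R] in
/-- The standard grading is the weight `(1, 1, 1)`. [folklore] -/
theorem isWeightedHomogeneous_one_iff (F : MvPolynomial (Fin 3) R) (n : ℕ) :
    F.IsWeightedHomogeneous (fun _ : Fin 3 => (1 : ℕ)) n ↔ F.IsHomogeneous n := Iff.rfl

include hgen hdim in
/-- **`in_μ(F(c)) = F̄`** for a form `F` of degree `μ`. [cite: CossartJannsenSaito2020, Def. 8.2] -/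
theorem inForm_one_eq_map {F : MvPolynomial (Fin 3) R} (hF : F.IsHomogeneous μ) :
    inForm c (fun _ => 1) μ (eval c F) = MvPolynomial.map (residue R) F := by
  have h : IsInForm c (fun _ => 1) μ (eval c F) (MvPolynomial.map (residue R) F) :=
    ⟨F, (isWeightedHomogeneous_one_iff F μ).mpr hF, rfl, by rw [sub_self]; exact Ideal.zero_mem _⟩
  exact (h.eq_inForm c hgen hdim (fun _ => Nat.one_pos)).symm

/-- A truncation of an exponent of degree `≥ μ` to an exponent `≤` it of degree exactly `μ`
(greedy). [folklore] -/
def truncExp (μ : ℕ) (m : Fin 3 →₀ ℕ) : Fin 3 →₀ ℕ :=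
  Finsupp.equivFunOnFinite.symm
    ![min (m 0) μ, min (m 1) (μ - min (m 0) μ), μ - min (m 0) μ - min (m 1) (μ - min (m 0) μ)]

omit [IsRegularLocalRing R] in
/-- Components of the truncation. [folklore] -/
theorem truncExp_apply (μ : ℕ) (m : Fin 3 →₀ ℕ) :
    truncExp μ m 0 = min (m 0) μ ∧ truncExp μ m 1 = min (m 1) (μ - min (m 0) μ) ∧
      truncExp μ m 2 = μ - min (m 0) μ - min (m 1) (μ - min (m 0) μ) := ⟨rfl, rfl, rfl⟩

omit [IsRegularLocalRing R] in
/-- The truncation is below the exponent (degree `≥ μ`). [folklore] -/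
theorem truncExp_le {μ : ℕ} {m : Fin 3 →₀ ℕ} (hm : μ ≤ m 0 + m 1 + m 2) : truncExp μ m ≤ m := by
  obtain ⟨h0, h1, h2⟩ := truncExp_apply μ m
  intro i
  fin_cases i
  · show truncExp μ m 0 ≤ m 0; rw [h0]; exact min_le_left _ _
  · show truncExp μ m 1 ≤ m 1; rw [h1]; exact min_le_left _ _
  · show truncExp μ m 2 ≤ m 2; rw [h2]; omega

omit [IsRegularLocalRing R] in
/-- The truncation has degree `μ` (degree `≥ μ`). [folklore] -/
theorem degree_truncExp (μ : ℕ) (m : Fin 3 →₀ ℕ) : (truncExp μ m).degree = μ := by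
  obtain ⟨h0, h1, h2⟩ := truncExp_apply μ m
  rw [Finsupp.degree_eq_sum, Fin.sum_univ_three, h0, h1, h2]
  omega

include hgen in
/-- Every `f ∈ 𝔪^μ` is `F(c)` for a form `F` of degree `μ` (coefficients in `R`). [folklore] -/
theorem exists_isHomogeneous_eval_eq {f : R} (hf : f ∈ maximalIdeal R ^ μ) :
    ∃ F : MvPolynomial (Fin 3) R, F.IsHomogeneous μ ∧ eval c F = f := by
  classical
  have hgenr := span_range_eq_of_span_triple c hgen
  rw [← weightedIdealW_one_eq_pow c hgenr] at hf
  obtain ⟨P, hP, hPf⟩ := (mem_weightedIdealW_iff_exists_mvPolynomial c (fun _ => 1) μ f).mp hf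
  have hdeg : ∀ m ∈ P.support, μ ≤ m 0 + m 1 + m 2 := fun m hm => by
    have := hP m hm; rwa [weight_one_eq] at this
  refine ⟨∑ m ∈ P.support, monomial (truncExp μ m) (P.coeff m * monom3 c (m - truncExp μ m)), ?_, ?_⟩
  · refine IsHomogeneous.sum _ _ _ fun m _ => ?_
    refine isHomogeneous_monomial _ ?_
    rw [degree_truncExp]
  · rw [← hPf]
    conv_rhs => rw [P.as_sum, map_sum]
    rw [map_sum]
    refine Finset.sum_congr rfl fun m hm => ?_
    rw [eval_monomial_eq_monom3, eval_monomial_eq_monom3, mul_assoc, ← monom3_add,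
      tsub_add_cancel_of_le (truncExp_le (hdeg m hm))]

include hgen hdim in
/-- **`cl_μ(J) = {in_μ(f) : f ∈ J}`** for `J ⊆ 𝔪^μ`. [cite: CossartPiltant2008, proof of Prop. 4.2] -/
theorem mem_initialForms_iff_exists_inForm (hJμ : J ≤ maximalIdeal R ^ μ)
    (G : MvPolynomial (Fin 3) (ResidueField R)) :
    G ∈ initialForms c J μ ↔ ∃ f ∈ J, inForm c (fun _ => 1) μ f = G := by
  constructor
  · rintro ⟨F, hF, hFJ, rfl⟩
    exact ⟨eval c F, hFJ, inForm_one_eq_map c hgen hdim hF⟩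
  · rintro ⟨f, hfJ, rfl⟩
    obtain ⟨F, hF, hFf⟩ := exists_isHomogeneous_eval_eq c hgen (hJμ hfJ)
    refine ⟨F, hF, by rw [hFf]; exact hfJ, ?_⟩
    rw [← hFf, inForm_one_eq_map c hgen hdim hF]

include hgen hdim in
/-- **`δ > 1 ⇒ cl_μ(J) ⊆ k · Y^μ`**: if `L < δs` then every degree-`μ` initial form of an element
of `J ⊆ 𝔪^μ` is a scalar multiple of `Y^μ` — `y` is adapted to the directrix and `τ ≤ 1`.
[cite: CossartJannsenSaito2020, (12.1)] [cite: CossartPiltant2008, §4 p. 11] -/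
theorem forall_initialForms_of_lt_deltaS (hJμ : J ≤ maximalIdeal R ^ μ)
    (hδ : μ.factorial < deltaS c J μ) :
    ∀ G ∈ initialForms c J μ, ∃ a : ResidueField R, G = C a * X 0 ^ μ := by
  classical
  intro G hG
  obtain ⟨f, hfJ, rfl⟩ := (mem_initialForms_iff_exists_inForm c hgen hdim hJμ G).mp hG
  have hgenr := span_range_eq_of_span_triple c hgen
  have h1 : ∀ i, 0 < (fun _ : Fin 3 => (1 : ℕ)) i := fun _ => Nat.one_pos
  obtain ⟨F, hFu, -, hFrem⟩ := exists_unitRep c hgenr f (μ + 1)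
  have hrem : f - eval c F ∈ weightedIdealW c (fun _ => 1) (μ + 1) :=
    pow_maximalIdeal_le_weightedIdealW c hgenr h1 _ hFrem
  have hf1 : f ∈ weightedIdealW c (fun _ => 1) μ := by rw [weightedIdealW_one_eq_pow c hgenr]; exact hJμ hfJ
  have hmin : ∀ m ∈ F.support, μ ≤ Finsupp.weight (fun _ : Fin 3 => (1 : ℕ)) m :=
    (mem_weightedIdealW_iff_of_unitRep c hgen hdim h1 hFu hrem (by omega)).mp hf1
  rw [inForm_eq_map_component c hgen hdim h1 le_rfl hrem hmin]
  -- every degree-`μ` monomial of `F` is `y^μ`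
  have hkey : ∀ m ∈ F.support, Finsupp.weight (fun _ : Fin 3 => (1 : ℕ)) m = μ → m = Finsupp.single 0 μ := by
    intro m hm hwt
    by_contra hne
    have hm0 : m 0 < μ := by
      rw [weight_one_eq] at hwt
      by_contra hge
      push Not at hge
      apply hne
      ext i; fin_cases i <;> simp <;> omega
    have hinit : IsInitialTerm c (fun _ => 1) f m := by
      refine (isInitialTerm_iff_of_unitRep c hgen hdim h1 hFu hrem (by omega)).mpr ⟨hm, ?_⟩
      intro m' hm'; rw [hwt]; exact hmin m' hm'
    have hpts : m ∈ pts c J μ := ⟨mem_occ_of_isInitialTerm c hfJ h1 hinit, hm0⟩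
    have hsum : spt₁ μ m + spt₂ μ m = μ.factorial := by
      rw [weight_one_eq] at hwt
      rw [spt₁, spt₂, ← add_mul, ← sub_mul_sfac hm0]
      congr 1; omega
    have := deltaS_le hpts
    omega
  refine ⟨residue R (F.coeff (Finsupp.single 0 μ)), ?_⟩
  ext m
  rw [coeff_map, coeff_weightedHomogeneousComponent, coeff_C_mul, coeff_X_pow]
  by_cases hm : Finsupp.single 0 μ = m
  · subst hm
    rw [if_pos (by rw [weight_one_eq]; simp), if_pos rfl, mul_one]
  · rw [if_neg hm, mul_zero]
    split_ifs with hwt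
    · by_cases hms : m ∈ F.support
      · exact absurd (hkey m hms hwt).symm hm
      · rw [notMem_support_iff.mp hms, map_zero]
    · rw [map_zero]

include hgen hdim in
/-- **`cl_μ(J) ⊆ k · Y^μ ⇒ δ > 1`** when Newton points are present (`J ⊆ 𝔪^μ`).
[cite: CossartJannsenSaito2020, (12.1)] [cite: CossartPiltant2008, §4 p. 12] -/
theorem lt_deltaS_of_forall_initialForms (hJμ : J ≤ maximalIdeal R ^ μ) (hne : (pts c J μ).Nonempty)
    (h : ∀ G ∈ initialForms c J μ, ∃ a : ResidueField R, G = C a * X 0 ^ μ) :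
    μ.factorial < deltaS c J μ := by
  classical
  by_contra hle
  push Not at hle
  obtain ⟨e, he, hsum⟩ := exists_pts_deltaS hne
  have hL := factorial_le_spt_add c hgen hdim hJμ he
  have hsumL : spt₁ μ e + spt₂ μ e = μ.factorial := by omega
  -- `e` has degree `μ`
  have he0 := he.2
  have hdeg : e 0 + e 1 + e 2 = μ := by
    rw [spt₁, spt₂, ← add_mul, ← sub_mul_sfac he0] at hsumL
    have := Nat.eq_of_mul_eq_mul_right (sfac_pos he0) hsumL
    omega
  -- an element of `J` with initial term `e`
  obtain ⟨f, hfJ, w, hw, hinit⟩ := he.1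
  have hgenr := span_range_eq_of_span_triple c hgen
  have h1 : ∀ i, 0 < (fun _ : Fin 3 => (1 : ℕ)) i := fun _ => Nat.one_pos
  set N := Finsupp.weight w e + μ + 2 with hN
  obtain ⟨F, hFu, -, hFrem⟩ := exists_unitRep c hgenr f N
  have hremw : f - eval c F ∈ weightedIdealW c w N := pow_maximalIdeal_le_weightedIdealW c hgenr hw _ hFrem
  have hrem1 : f - eval c F ∈ weightedIdealW c (fun _ => 1) N := pow_maximalIdeal_le_weightedIdealW c hgenr h1 _ hFrem
  have heF : e ∈ F.support := ((isInitialTerm_iff_of_unitRep c hgen hdim hw hFu hremw (by omega)).mp hinit).1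
  have hf1 : f ∈ weightedIdealW c (fun _ => 1) μ := by rw [weightedIdealW_one_eq_pow c hgenr]; exact hJμ hfJ
  have hmin : ∀ m ∈ F.support, μ ≤ Finsupp.weight (fun _ : Fin 3 => (1 : ℕ)) m :=
    (mem_weightedIdealW_iff_of_unitRep c hgen hdim h1 hFu hrem1 (by omega)).mp hf1
  have hin := inForm_eq_map_component c hgen hdim h1 (by omega) hrem1 hmin
  -- `in_μ(f) ∈ cl_μ(J)` is a multiple of `Y^μ`, but has a unit coefficient at `e ≠ (μ,0,0)`
  obtain ⟨a, ha⟩ := h _ ((mem_initialForms_iff_exists_inForm c hgen hdim hJμ _).mpr ⟨f, hfJ, rfl⟩)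
  have hcoeff := congrArg (fun G => G.coeff e) ha
  rw [hin, coeff_map, coeff_weightedHomogeneousComponent, if_pos (by rw [weight_one_eq]; exact hdeg),
    coeff_C_mul, coeff_X_pow, if_neg, mul_zero, residue_eq_zero_iff] at hcoeff
  · exact (mem_maximalIdeal _).mp hcoeff (hFu e heF)
  · intro heq
    have := congrArg (fun m => m 0) heq
    simp at this
    omega

end Adapted

end Literature.AlgebraicGeometry.Resolution
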